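import Literature.Analysis.Calculus.CoordinateJets
import Mathlib.Topology.MetricSpace.Thickening
import Mathlib.Analysis.Normed.Module.FiniteDimension
import HarnessLib

/-!
# Uniform ellipticity near the graph of a solution from a pointwise bound

Calculus layer (everything proved, no named facts) for the regularity half of
Gilbarg–Trudinger (2001), Lemma 17.16 as used in the Gursky–Viaclovsky openness step
(`Literature.Geometry.Riemannian.gurskyViaclovsky_pathOpen_weighted_four`). A fully nonlinear
equation `H(c(y), J²v(y)) = 0` in coordinate jets (`Literature/Analysis/Calculus/CoordinateJets.lean`)
is elliptic ALONG a solution when the top-order symbol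
`σ_{(p, J)}(η) = ∂H(p, J)·(0, single₂(η ⊗ η))` satisfies `λ‖η‖² ≤ σ_{(c y, J²v(y))}(η)` at the
points of the graph. The difference-quotient argument needs the bound at jets NEAR the graph
(the averaged coefficients live on segments between neighbouring jets). For `H ∈ C¹` and
continuous data on a closed ball this is automatic, with half the constant:

* `exists_ellipticity_nhds_graph` — from `λ‖η‖² ≤ σ_{(c y, J²v(y))}(η)` on `closedBall x₀ R` to
  `(λ/2)‖η‖² ≤ σ_{(p', J')}(η)` whenever `‖p' − c y‖ < δ`, `‖J' − J²v(y)‖ < δ`, `y ∈ ball x₀ R`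
  (compactness of the graph over the closed ball and of the unit sphere of covectors, uniform
  continuity of the symbol on a compact neighbourhood, homogeneity of degree two in `η`).

## References

* D. Gilbarg, N. S. Trudinger, *Elliptic Partial Differential Equations of Second Order* (2001),
  Lemma 17.16. [GilbargTrudinger2001]
-/

noncomputable section

open Set Function Metric Filter
open scoped Topology NNReal

namespace Literature.Analysis.Calculus

variable {ι : Type*} [Fintype ι] {E : Type*} [NormedAddCommGroup E]
  [InnerProductSpace ℝ E]
  {P : Type*} [NormedAddCommGroup P] [NormedSpace ℝ P]

/-- The entries of the rank-one top-slot direction depend continuously on `η`. [folklore] -/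
theorem continuous_single_last_entries (bE : OrthonormalBasis ι ℝ E) :
    Continuous fun η : E →L[ℝ] ℝ => fun I : Fin 2 → ι => η (bE (I 0)) * η (bE (I 1)) :=
  continuous_pi fun I =>
    ((ContinuousLinearMap.apply ℝ ℝ (bE (I 0))).continuous).mul
      ((ContinuousLinearMap.apply ℝ ℝ (bE (I 1))).continuous)

variable [FiniteDimensional ℝ E] [FiniteDimensional ℝ P]

/-- **Uniform ellipticity near the graph from a pointwise bound on a closed ball.** Let
`H : P × CJet ι 2 → ℝ` be `C¹`, `c` and `y ↦ J²v(y)` continuous on `closedBall x₀ R`, and suppose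
`λ‖η‖² ≤ ∂H(c y, J²v(y))·(0, single₂(η⊗η))` for all `y` in the closed ball and all covectors `η`,
with `λ > 0`. Then there is `δ > 0` such that `(λ/2)‖η‖² ≤ ∂H(p', J')·(0, single₂(η⊗η))` whenever
`y ∈ ball x₀ R`, `‖p' − c y‖ < δ` and `‖J' − J²v(y)‖ < δ`. [cite: GilbargTrudinger2001, Lemma 17.16] -/
theorem exists_ellipticity_nhds_graph (bE : OrthonormalBasis ι ℝ E) {H : P × CJet ι 2 → ℝ}
    (hH : ContDiff ℝ 1 H) {c : E → P} {v : E → ℝ} {x₀ : E} {R : ℝ}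
    (hc : ContinuousOn c (closedBall x₀ R)) (hv : ContinuousOn (cjetOf bE 2 v) (closedBall x₀ R))
    {lam : ℝ} (hlam : 0 < lam)
    (hpt : ∀ y ∈ closedBall x₀ R, ∀ η : E →L[ℝ] ℝ, lam * ‖η‖ ^ 2 ≤
      fderiv ℝ H (c y, cjetOf bE 2 v y) ((0 : P), Pi.single (Fin.last 2)
        (fun I : Fin 2 → ι => η (bE (I 0)) * η (bE (I 1))))) :
    ∃ l δ : ℝ, 0 < l ∧ 0 < δ ∧ ∀ y ∈ ball x₀ R, ∀ (p' : P) (J' : CJet ι 2),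
      ‖p' - c y‖ < δ → ‖J' - cjetOf bE 2 v y‖ < δ → ∀ η : E →L[ℝ] ℝ, l * ‖η‖ ^ 2 ≤
        fderiv ℝ H (p', J') ((0 : P), Pi.single (Fin.last 2)
          (fun I : Fin 2 → ι => η (bE (I 0)) * η (bE (I 1)))) := by
  classical
  -- the symbol as a continuous function of (point of the jet space, covector)
  let F : (P × CJet ι 2) × (E →L[ℝ] ℝ) → ℝ := fun q => fderiv ℝ H q.1 ((0 : P),
    Pi.single (Fin.last 2) (fun I : Fin 2 → ι => q.2 (bE (I 0)) * q.2 (bE (I 1))))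
  have hF : ∀ (z : P × CJet ι 2) (η : E →L[ℝ] ℝ), F (z, η) = fderiv ℝ H z ((0 : P),
      Pi.single (Fin.last 2) (fun I : Fin 2 → ι => η (bE (I 0)) * η (bE (I 1)))) := fun _ _ => rfl
  have hFc : Continuous F := by
    have h1 : Continuous fun q : (P × CJet ι 2) × (E →L[ℝ] ℝ) => fderiv ℝ H q.1 :=
      (hH.continuous_fderiv one_ne_zero).comp continuous_fst
    have h2 : Continuous fun q : (P × CJet ι 2) × (E →L[ℝ] ℝ) =>
        (((0 : P), Pi.single (Fin.last 2)
          (fun I : Fin 2 → ι => q.2 (bE (I 0)) * q.2 (bE (I 1)))) : P × CJet ι 2) := by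
      refine continuous_const.prodMk ?_
      have h3 : Continuous fun Ω : (Fin 2 → ι) → ℝ => (Pi.single (Fin.last 2) Ω : CJet ι 2) :=
        (LinearMap.single ℝ (fun j : Fin (2 + 1) => (Fin (j : ℕ) → ι) → ℝ) (Fin.last 2)).continuous_of_finiteDimensional
      exact h3.comp ((continuous_single_last_entries bE).comp continuous_snd)
    exact h1.clm_apply h2
  -- the compact set: the `1`-thickening of the graph over the closed ball, times the unit sphere
  set K : Set (P × CJet ι 2) := (fun y => (c y, cjetOf bE 2 v y)) '' closedBall x₀ R with hK
  have hKc : IsCompact K := (isCompact_closedBall x₀ R).image_of_continuousOn (hc.prodMk hv)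
  haveI : ProperSpace (P × CJet ι 2) := FiniteDimensional.proper ℝ _
  have hK₁ : IsCompact (cthickening 1 K) := hKc.cthickening
  have hS : IsCompact (sphere (0 : E →L[ℝ] ℝ) 1) := isCompact_sphere _ _
  have hKS : IsCompact (cthickening 1 K ×ˢ sphere (0 : E →L[ℝ] ℝ) 1) := hK₁.prod hS
  -- uniform continuity of `F` there
  have hunif := hKS.uniformContinuousOn_of_continuous hFc.continuousOn
  rw [Metric.uniformContinuousOn_iff] at hunif
  obtain ⟨δ₀, hδ₀, hδ⟩ := hunif (lam / 2) (by positivity)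
  refine ⟨lam / 2, min δ₀ 1 / 2, by positivity, by positivity, fun y hy p' J' hp hJ η => ?_⟩
  have hyc : y ∈ closedBall x₀ R := ball_subset_closedBall hy
  -- homogeneity: both sides scale by `s²` under `η ↦ s • η`
  have hdir : ∀ (s : ℝ) (η₁ : E →L[ℝ] ℝ),
      (Pi.single (Fin.last 2) (fun I : Fin 2 → ι => (s • η₁) (bE (I 0)) * (s • η₁) (bE (I 1))) :
          CJet ι 2) =
        s ^ 2 • (Pi.single (Fin.last 2) (fun I : Fin 2 → ι => η₁ (bE (I 0)) * η₁ (bE (I 1))) :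
          CJet ι 2) := by
    intro s η₁
    ext j I
    rw [Pi.smul_apply, Pi.smul_apply, smul_eq_mul]
    by_cases hj : j = Fin.last 2
    · subst hj
      rw [Pi.single_eq_same, Pi.single_eq_same]
      simp only [FunLike.coe_smul, Pi.smul_apply, smul_eq_mul]
      ring
    · rw [Pi.single_eq_of_ne hj, Pi.single_eq_of_ne hj]
      simp
  have hscale : ∀ (z : P × CJet ι 2) (s : ℝ) (η₁ : E →L[ℝ] ℝ),
      F (z, s • η₁) = s ^ 2 * F (z, η₁) := by
    intro z s η₁
    rw [hF, hF, hdir s η₁,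
      show (((0 : P), s ^ 2 • (Pi.single (Fin.last 2)
        (fun I : Fin 2 → ι => η₁ (bE (I 0)) * η₁ (bE (I 1))) : CJet ι 2)) : P × CJet ι 2) =
        s ^ 2 • ((0 : P), (Pi.single (Fin.last 2)
          (fun I : Fin 2 → ι => η₁ (bE (I 0)) * η₁ (bE (I 1))) : CJet ι 2)) by
        rw [Prod.smul_mk, smul_zero], map_smul, smul_eq_mul]
  rcases eq_or_ne η 0 with rfl | hη
  · have h0 : F ((p', J'), (0 : E →L[ℝ] ℝ)) = 0 := by
      have h := hscale (p', J') 0 0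
      rw [zero_smul] at h
      rw [h]
      ring
    rw [← hF (p', J') 0, h0, norm_zero]
    ring_nf
    exact le_rfl
  · set s : ℝ := ‖η‖ with hs
    have hs0 : 0 < s := norm_pos_iff.2 hη
    set η₁ : E →L[ℝ] ℝ := s⁻¹ • η with hη₁
    have hη₁n : ‖η₁‖ = 1 := by
      rw [hη₁, norm_smul, norm_inv, norm_norm, inv_mul_cancel₀ hs0.ne']
    have hηs : η = s • η₁ := by rw [hη₁, smul_smul, mul_inv_cancel₀ hs0.ne', one_smul]
    -- the two points are `δ₀`-close in the compact set
    have hz : (c y, cjetOf bE 2 v y) ∈ K := ⟨y, hyc, rfl⟩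
    have hzK : (c y, cjetOf bE 2 v y) ∈ cthickening 1 K := self_subset_cthickening K hz
    have hdist : dist ((p', J') : P × CJet ι 2) (c y, cjetOf bE 2 v y) < min δ₀ 1 / 2 := by
      rw [Prod.dist_eq, dist_eq_norm, dist_eq_norm]
      exact max_lt hp hJ
    have hpK : ((p', J') : P × CJet ι 2) ∈ cthickening 1 K := by
      refine Metric.mem_cthickening_of_dist_le _ _ 1 K hz ?_
      have h1 : min δ₀ 1 / 2 ≤ 1 := by
        have := min_le_right δ₀ 1
        linarith
      exact hdist.le.trans h1
    have hη₁S : η₁ ∈ sphere (0 : E →L[ℝ] ℝ) 1 := by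
      rw [mem_sphere_zero_iff_norm, hη₁n]
    have hclose : dist (((p', J'), η₁) : (P × CJet ι 2) × (E →L[ℝ] ℝ))
        ((c y, cjetOf bE 2 v y), η₁) < δ₀ := by
      rw [Prod.dist_eq, dist_self, max_eq_left dist_nonneg]
      have h1 : min δ₀ 1 / 2 < δ₀ := by
        have := min_le_left δ₀ 1
        linarith
      exact hdist.trans h1
    have hFd := hδ ((p', J'), η₁) (Set.mk_mem_prod hpK hη₁S) ((c y, cjetOf bE 2 v y), η₁)
      (Set.mk_mem_prod hzK hη₁S) hclose
    rw [Real.dist_eq] at hFd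
    have hpt₁ := hpt y hyc η₁
    rw [hη₁n, one_pow, mul_one, ← hF (c y, cjetOf bE 2 v y) η₁] at hpt₁
    have h1 : lam / 2 ≤ F ((p', J'), η₁) := by
      have := (abs_sub_lt_iff.1 hFd).2
      linarith
    rw [← hF (p', J') η, hηs, hscale]
    calc lam / 2 * s ^ 2 = s ^ 2 * (lam / 2) := by ring
      _ ≤ s ^ 2 * F ((p', J'), η₁) := mul_le_mul_of_nonneg_left h1 (sq_nonneg _)

/-- **Uniform ellipticity near the graph from STRICT POSITIVITY on a closed ball.** Let
`H : P × CJet ι 2 → ℝ` be `C¹`, `c` and `y ↦ J²v(y)` continuous on `closedBall x₀ R`, and suppose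
`0 < ∂H(c y, J²v(y))·(0, single₂(η⊗η))` for all `y` in the closed ball and all covectors `η ≠ 0`.
Then there are `l, δ > 0` with `l‖η‖² ≤ ∂H(p', J')·(0, single₂(η⊗η))` whenever `y ∈ ball x₀ R`,
`‖p' − c y‖ < δ` and `‖J' − J²v(y)‖ < δ`: the symbol is continuous and homogeneous of degree two in
`η`, so its minimum over (graph over the closed ball) × (unit sphere of covectors) — a compact set —
is a positive uniform constant, and `exists_ellipticity_nhds_graph` applies.
[cite: GilbargTrudinger2001, Lemma 17.16] -/
theorem exists_ellipticity_nhds_graph_of_pos (bE : OrthonormalBasis ι ℝ E)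
    {H : P × CJet ι 2 → ℝ} (hH : ContDiff ℝ 1 H) {c : E → P} {v : E → ℝ} {x₀ : E} {R : ℝ}
    (hc : ContinuousOn c (closedBall x₀ R)) (hv : ContinuousOn (cjetOf bE 2 v) (closedBall x₀ R))
    (hpt : ∀ y ∈ closedBall x₀ R, ∀ η : E →L[ℝ] ℝ, η ≠ 0 → 0 <
      fderiv ℝ H (c y, cjetOf bE 2 v y) ((0 : P), Pi.single (Fin.last 2)
        (fun I : Fin 2 → ι => η (bE (I 0)) * η (bE (I 1))))) :
    ∃ l δ : ℝ, 0 < l ∧ 0 < δ ∧ ∀ y ∈ ball x₀ R, ∀ (p' : P) (J' : CJet ι 2),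
      ‖p' - c y‖ < δ → ‖J' - cjetOf bE 2 v y‖ < δ → ∀ η : E →L[ℝ] ℝ, l * ‖η‖ ^ 2 ≤
        fderiv ℝ H (p', J') ((0 : P), Pi.single (Fin.last 2)
          (fun I : Fin 2 → ι => η (bE (I 0)) * η (bE (I 1)))) := by
  classical
  -- the symbol along the graph as a continuous function of (base point, covector)
  let F : E × (E →L[ℝ] ℝ) → ℝ := fun q => fderiv ℝ H (c q.1, cjetOf bE 2 v q.1) ((0 : P),
    Pi.single (Fin.last 2) (fun I : Fin 2 → ι => q.2 (bE (I 0)) * q.2 (bE (I 1))))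
  have hF : ∀ (y : E) (η : E →L[ℝ] ℝ), F (y, η) = fderiv ℝ H (c y, cjetOf bE 2 v y) ((0 : P),
      Pi.single (Fin.last 2) (fun I : Fin 2 → ι => η (bE (I 0)) * η (bE (I 1)))) := fun _ _ => rfl
  have hFc : ContinuousOn F (closedBall x₀ R ×ˢ univ) := by
    have h1 : ContinuousOn (fun q : E × (E →L[ℝ] ℝ) => fderiv ℝ H (c q.1, cjetOf bE 2 v q.1))
        (closedBall x₀ R ×ˢ univ) := by
      refine (hH.continuous_fderiv one_ne_zero).comp_continuousOn ?_
      exact (hc.prodMk hv).comp continuous_fst.continuousOn fun q hq => hq.1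
    have h2 : Continuous fun q : E × (E →L[ℝ] ℝ) =>
        (((0 : P), Pi.single (Fin.last 2)
          (fun I : Fin 2 → ι => q.2 (bE (I 0)) * q.2 (bE (I 1)))) : P × CJet ι 2) := by
      refine continuous_const.prodMk ?_
      have h3 : Continuous fun Ω : (Fin 2 → ι) → ℝ => (Pi.single (Fin.last 2) Ω : CJet ι 2) :=
        (LinearMap.single ℝ (fun j : Fin (2 + 1) => (Fin (j : ℕ) → ι) → ℝ) (Fin.last 2)).continuous_of_finiteDimensional
      exact h3.comp ((continuous_single_last_entries bE).comp continuous_snd)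
    exact h1.clm_apply h2.continuousOn
  -- homogeneity of degree two in the covector
  have hdir : ∀ (s : ℝ) (η₁ : E →L[ℝ] ℝ),
      (Pi.single (Fin.last 2) (fun I : Fin 2 → ι => (s • η₁) (bE (I 0)) * (s • η₁) (bE (I 1))) :
          CJet ι 2) =
        s ^ 2 • (Pi.single (Fin.last 2) (fun I : Fin 2 → ι => η₁ (bE (I 0)) * η₁ (bE (I 1))) :
          CJet ι 2) := by
    intro s η₁
    ext j I
    rw [Pi.smul_apply, Pi.smul_apply, smul_eq_mul]
    by_cases hj : j = Fin.last 2
    · subst hj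
      rw [Pi.single_eq_same, Pi.single_eq_same]
      simp only [FunLike.coe_smul, Pi.smul_apply, smul_eq_mul]
      ring
    · rw [Pi.single_eq_of_ne hj, Pi.single_eq_of_ne hj]
      simp
  have hscale : ∀ (y : E) (s : ℝ) (η₁ : E →L[ℝ] ℝ), F (y, s • η₁) = s ^ 2 * F (y, η₁) := by
    intro y s η₁
    rw [hF, hF, hdir s η₁,
      show (((0 : P), s ^ 2 • (Pi.single (Fin.last 2)
        (fun I : Fin 2 → ι => η₁ (bE (I 0)) * η₁ (bE (I 1))) : CJet ι 2)) : P × CJet ι 2) =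
        s ^ 2 • ((0 : P), (Pi.single (Fin.last 2)
          (fun I : Fin 2 → ι => η₁ (bE (I 0)) * η₁ (bE (I 1))) : CJet ι 2)) by
        rw [Prod.smul_mk, smul_zero], map_smul, smul_eq_mul]
  have hzero : ∀ y : E, F (y, 0) = 0 := fun y => by
    have h := hscale y 0 0
    rw [zero_smul] at h
    rw [h]
    ring
  -- a positive uniform constant on the closed ball: the minimum over the compact set
  -- (closed ball) × (unit sphere of covectors), or `1` if that set is empty
  haveI : ProperSpace E := FiniteDimensional.proper ℝ E
  have hS : IsCompact (closedBall x₀ R ×ˢ sphere (0 : E →L[ℝ] ℝ) 1) :=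
    (isCompact_closedBall x₀ R).prod (isCompact_sphere _ _)
  obtain ⟨lam, hlam, hlamle⟩ : ∃ lam : ℝ, 0 < lam ∧ ∀ y ∈ closedBall x₀ R,
      ∀ η₁ ∈ sphere (0 : E →L[ℝ] ℝ) 1, lam ≤ F (y, η₁) := by
    rcases (closedBall x₀ R ×ˢ sphere (0 : E →L[ℝ] ℝ) 1).eq_empty_or_nonempty with h0 | hne
    · refine ⟨1, one_pos, fun y hy η₁ hη₁ => ?_⟩
      have hmem : (y, η₁) ∈ closedBall x₀ R ×ˢ sphere (0 : E →L[ℝ] ℝ) 1 := Set.mk_mem_prod hy hη₁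
      rw [h0] at hmem
      exact (Set.notMem_empty _ hmem).elim
    · obtain ⟨p₀, hp₀, hmin⟩ := hS.exists_isMinOn hne
        (hFc.mono (Set.prod_mono Subset.rfl (subset_univ _)))
      have hη0 : p₀.2 ≠ 0 := by
        intro h
        have h1 := hp₀.2
        rw [mem_sphere_zero_iff_norm, h, norm_zero] at h1
        exact zero_ne_one h1
      refine ⟨F p₀, ?_, fun y hy η₁ hη₁ => isMinOn_iff.1 hmin (y, η₁) (Set.mk_mem_prod hy hη₁)⟩
      have h := hpt p₀.1 hp₀.1 p₀.2 hη0
      rwa [← hF] at h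
  refine exists_ellipticity_nhds_graph bE hH hc hv hlam fun y hy η => ?_
  -- the pointwise bound with constant `lam`, by homogeneity
  rw [← hF]
  rcases eq_or_ne η 0 with rfl | hη
  · rw [hzero, norm_zero]
    ring_nf
    exact le_rfl
  · set s : ℝ := ‖η‖ with hs
    have hs0 : 0 < s := norm_pos_iff.2 hη
    set η₁ : E →L[ℝ] ℝ := s⁻¹ • η with hη₁
    have hη₁n : ‖η₁‖ = 1 := by
      rw [hη₁, norm_smul, norm_inv, norm_norm, inv_mul_cancel₀ hs0.ne']
    have hηs : η = s • η₁ := by rw [hη₁, smul_smul, mul_inv_cancel₀ hs0.ne', one_smul]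
    have hη₁S : η₁ ∈ sphere (0 : E →L[ℝ] ℝ) 1 := by
      rw [mem_sphere_zero_iff_norm, hη₁n]
    have h1 := hlamle y hy η₁ hη₁S
    rw [hηs, hscale]
    calc lam * s ^ 2 = s ^ 2 * lam := by ring
      _ ≤ s ^ 2 * F (y, η₁) := mul_le_mul_of_nonneg_left h1 (sq_nonneg _)

end Literature.Analysis.Calculus

end
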